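import Summits.AtomisticToContinuum.BoseEinsteinCondensation.Theorems.BECThomsonPrincipleGaussianDominationCanChordTransport
import Summits.AtomisticToContinuum.BoseEinsteinCondensation.Theorems.BECThomsonPrincipleGaussianDominationCanFreeCase
import Mathlib.Analysis.Calculus.MeanValue
import HarnessLib

/-!
# Route `BECThomsonPrinciple`, crux `GaussianDominationCan` (stmt-AtomisticToContinuum-9479),
# line `coupling-monotone-chord` (skeleton r8) — side stub S4 `stub_chordTransportFrom`
# (per-`s` chord transport from an interior ray point)

The landed engine C `stub_chordTransport` (`…GaussianDominationCanChordTransport.lean`) sharpened in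
two ways: the source strength `s ≥ 0` is FIXED, and the transport starts at an interior ray point
`τ₀ ∈ [0, 1)` from ANY chord valid at `τ₀ • w` with a constant `C₁ > 0` (instead of at `τ = 0` from the
free chord).  With `F(τ, s', Φ) = sourcedFunctional (τ • w) … s' Φ`, `e(s', τ) = inf_Φ F(τ, s', Φ)` and
`D = e(0, ·) - e(s, ·)` (the energy drop caused by the source), the sign hypothesis at the ray points
`τ ∈ (τ₀, 1)` makes the lower right Dini derivative of `D` non-positive there (`ray_dini`), so
`D(1) ≤ D(ε)` for `ε ∈ (τ₀, 1)` (`image_le_of_liminf_slope_right_le_deriv_boundary` with a constant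
bound) and `ε → τ₀⁺` by continuity (`ray_continuousOn`) gives `D(1) ≤ D(τ₀)` — the abstract
`ray_transport_from` of §Ray, verbatim the landed `ray_transport` with `0` replaced by `τ₀`.  The
concrete ends: `e(0, 1) = E₀(w)`, `e(0, τ₀) = E₀(τ₀ • w)` (all energies along the ray of a bounded
potential are finite), the chord at `τ₀ • w` read in `ℝ` gives `E₀(τ₀ • w) - C₁ s² L²/‖n‖² ≤ e(s, τ₀)`,
and `e(s, 1) ≤ E_w(Φ) - s·2N|I(Φ)|`; the free chord `stub_freeCase` (sharp constant `1/(4π²)`) only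
serves to bound the sourced functional below.  Reference: W. Thirring, *Quantum Mathematical Physics*
§3.5 (concavity in linear parameters; Feynman–Hellmann).  All statements here are [folklore].
-/

noncomputable section

namespace Summit.AtomisticToContinuum.BoseEinsteinCondensation.Cruxes.GaussianDominationCan.CouplingMonotoneChord

open MeasureTheory Set Filter Topology
open scoped ENNReal NNReal
open Literature.MathematicalPhysics.QuantumManyBody.BoseGas
open Summit.AtomisticToContinuum.BoseEinsteinCondensation.Theorems.GaussianDominationCan.Negative
  (GDIneq sourceIntegral periodicInteraction_zero constState)

/-! ### §Ray: transport from an interior point (abstract) -/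

/-- TRANSPORT FROM AN INTERIOR RAY POINT: in the abstract setting of
`…GaussianDominationCanChordTransport` §Ray (`e(s', τ) = inf_Φ [t + τ⁺W - s'J]`, `g` the least
interaction of `δ`-near-minimisers), the sign `⨆_δ g(0, δ, τ) ≤ ⨆_δ g(s, δ, τ)` at every `τ ∈ (τ₀, 1)`,
`0 ≤ τ₀ < 1`, gives `D(1) ≤ D(ε)` for `ε ∈ (τ₀, 1)` (continuity, the Dini step `ray_dini` and
`image_le_of_liminf_slope_right_le_deriv_boundary` with a constant bound), and `ε → τ₀⁺` gives
`e(0, 1) - e(s, 1) ≤ e(0, τ₀) - e(s, τ₀)`. [folklore] -/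
theorem ray_transport_from {S : Type*} [Nonempty S] {t J : S → ℝ} {W : S → ℝ≥0∞} {Wm : ℝ}
    {F : ℝ → ℝ → S → ℝ} {e : ℝ → ℝ → ℝ} {g : ℝ → ℝ → ℝ → ℝ≥0∞} {b : ℝ → ℝ}
    (hWle : ∀ Φ, W Φ ≤ ENNReal.ofReal Wm) (hWm : 0 ≤ Wm)
    (hF : ∀ τ s' Φ, F τ s' Φ = t Φ + max τ 0 * (W Φ).toReal - s' * J Φ)
    (he : ∀ s' τ, e s' τ = ⨅ Φ, F τ s' Φ)
    (hg : ∀ s' δ τ, g s' δ τ = ⨅ (Φ : S) (_ : F τ s' Φ ≤ e s' τ + δ), W Φ)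
    (hb : ∀ s' τ Φ, b s' ≤ F τ s' Φ) {s τ₀ : ℝ} (hτ₀ : 0 ≤ τ₀) (hτ₀1 : τ₀ < 1)
    (hG : ∀ τ : ℝ, τ₀ < τ → τ < 1 →
      ⨆ (δ : ℝ) (_ : 0 < δ), g 0 δ τ ≤ ⨆ (δ : ℝ) (_ : 0 < δ), g s δ τ) :
    e 0 1 - e s 1 ≤ e 0 τ₀ - e s τ₀ := by
  have hcont : ContinuousOn (fun x => e 0 x - e s x) (Ici 0) :=
    (ray_continuousOn hWle hWm hF he hb 0).sub (ray_continuousOn hWle hWm hF he hb s)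
  have hDε : ∀ ε : ℝ, τ₀ < ε → ε < 1 → e 0 1 - e s 1 ≤ e 0 ε - e s ε := fun ε hε hε1 =>
    image_le_of_liminf_slope_right_le_deriv_boundary (f := fun x => e 0 x - e s x) (a := ε) (b := 1)
      (hcont.mono fun x hx => (hτ₀.trans hε.le).trans hx.1) (B := fun _ => e 0 ε - e s ε)
      (B' := fun _ => 0) le_rfl continuousOn_const
      (fun x _ => hasDerivWithinAt_const x (Ici x) (e 0 ε - e s ε))
      (fun x hx _ hr => ray_dini hWle hWm hF he hg hb ((hτ₀.trans hε.le).trans hx.1)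
        (hG x (hε.trans_le hx.1) hx.2) hr)
      (right_mem_Icc.2 hε1.le)
  -- `ε → τ₀⁺` by continuity at `τ₀` within `[0, ∞)`
  exact ge_of_tendsto
    ((hcont τ₀ (Set.mem_Ici.2 hτ₀)).mono (Ioi_subset_Ici_self.trans (Ici_subset_Ici.2 hτ₀)))
    (Filter.eventually_of_mem (Ioo_mem_nhdsGT hτ₀1) fun ε hε => hDε ε hε.1 hε.2)

/-! ### §Concrete: the registered stub -/

/-- **Registered side stub S4 `stub_chordTransportFrom`** (line `coupling-monotone-chord`, skeleton r8,
crux stmt-AtomisticToContinuum-9479): per-`s` chord transport from an interior ray point.  For a bounded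
admissible `w`, fixed `(m, L > 0, n ≠ 0, s ≥ 0)` and `τ₀ ∈ [0, 1)`: if the source at strength `s` does
not lower the ground-state interaction energy at every ray point `τ • w`, `τ ∈ (τ₀, 1]`, then a chord at
`s` valid at `τ₀ • w` with constant `C₁ > 0` (every trial state) is valid at `w`.  Variational
Hellmann–Feynman (`ray_transport_from`) applied to `F(τ, s', Φ) = sourcedFunctional (τ • w) … s' Φ`
(bounded below by the free chord `stub_freeCase`), with the ends `e(0, 1) = E₀(w)`,
`e(0, τ₀) = E₀(τ₀ • w)`, `e(s, τ₀) ≥ E₀(τ₀ • w) - C₁ s² L²/‖n‖²`, `e(s, 1) ≤ E_w(Φ) - s·2N|I(Φ)|`.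
[folklore] -/
theorem stub_chordTransportFrom :
    ∀ w : ℝ → ℝ≥0∞, IsRepulsiveFiniteRange w → (∃ B : ℝ, ∀ r, w r ≤ ENNReal.ofReal B) →
      ∀ m : ℕ, ∀ L : ℝ, 0 < L → ∀ n : Fin 3 → ℤ, n ≠ 0 → ∀ s : ℝ, 0 ≤ s → ∀ τ₀ : ℝ, 0 ≤ τ₀ → τ₀ < 1 →
        (∀ τ : ℝ, τ₀ < τ → τ ≤ 1 →
          groundInteraction (scalePot τ w) m L n 0 ≤ groundInteraction (scalePot τ w) m L n s) →
        ∀ C₁ : ℝ, 0 < C₁ → (∀ Φ : PeriodicTrialState (m + 1) L, GDIneq (scalePot τ₀ w) m L n C₁ s Φ) →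
        ∀ Φ : PeriodicTrialState (m + 1) L, GDIneq w m L n C₁ s Φ := by
  intro w hw hB m L hL n hn s hs τ₀ hτ₀ hτ₀1 hSRI C₁ hC₁ hchord Φ₀
  have hc : ((Real.sqrt (L ^ 3))⁻¹) ^ 2 * L ^ 3 = 1 := by
    rw [inv_pow, Real.sq_sqrt (by positivity), inv_mul_cancel₀ (by positivity)]
  haveI : Nonempty (PeriodicTrialState (m + 1) L) := ⟨constState m hL _ hc⟩
  obtain ⟨Wm, hWm, hW⟩ := exists_interactionEnergy_le hw hB hL (m + 1)
  -- the real objects of the ray analysis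
  set F : ℝ → ℝ → PeriodicTrialState (m + 1) L → ℝ :=
    fun τ s' Φ => sourcedFunctional (scalePot τ w) m L n s' Φ with hFdef
  obtain ⟨e, he⟩ : ∃ e : ℝ → ℝ → ℝ, ∀ s' τ, e s' τ = ⨅ Φ, F τ s' Φ := ⟨_, fun _ _ => rfl⟩
  obtain ⟨g, hg⟩ : ∃ g : ℝ → ℝ → ℝ → ℝ≥0∞, ∀ s' δ τ, g s' δ τ =
      ⨅ (Φ : PeriodicTrialState (m + 1) L) (_ : F τ s' Φ ≤ e s' τ + δ), interactionEnergy w Φ :=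
    ⟨_, fun _ _ _ => rfl⟩
  have hF : ∀ τ s' Φ, F τ s' Φ = (periodicEnergy 0 Φ).toReal + max τ 0 * (interactionEnergy w Φ).toReal
      - s' * (2 * (m + 1) * ‖sourceIntegral m L n Φ.ψ‖) :=
    fun τ s' Φ => sourcedFunctional_scalePot hW τ s' Φ
  -- the lower bound from the free chord (sharp constant `1/(4π²)`, `stub_freeCase`)
  have hfree : GDChordBody 0 (1 / (4 * Real.pi ^ 2)) m L n := stub_freeCase m L hL n hn
  have hb : ∀ s' τ Φ, (periodicGroundStateEnergy 0 (m + 1) L).toReal -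
      1 / (4 * Real.pi ^ 2) * s' ^ 2 * L ^ 2 / ‖(fun j => (n j : ℝ))‖ ^ 2 ≤ F τ s' Φ :=
    fun s' τ Φ => sourcedFunctional_ge_of_free hW (by positivity) hfree s' τ Φ
  have hbdd : ∀ s' τ, BddBelow (Set.range fun Φ : PeriodicTrialState (m + 1) L =>
      sourcedFunctional (scalePot τ w) m L n s' Φ) :=
    fun s' τ => ⟨_, Set.forall_mem_range.2 (hb s' τ)⟩
  -- the sign hypothesis with `τ > τ₀ ≥ 0` cancelled: `G(0, τ) ≤ G(s, τ)`
  have hG : ∀ τ : ℝ, τ₀ < τ → τ < 1 →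
      ⨆ (δ : ℝ) (_ : 0 < δ), g 0 δ τ ≤ ⨆ (δ : ℝ) (_ : 0 < δ), g s δ τ := by
    intro τ hτ hτ1
    have hτ0 : 0 < τ := hτ₀.trans_lt hτ
    have h := hSRI τ hτ hτ1.le
    rw [groundInteraction_scalePot_eq hW hτ0 (he 0 τ) (hbdd 0 τ) fun δ => hg 0 δ τ,
      groundInteraction_scalePot_eq hW hτ0 (he s τ) (hbdd s τ) fun δ => hg s δ τ] at h
    exact (ENNReal.mul_le_mul_iff_right (ENNReal.ofReal_pos.2 hτ0).ne' ENNReal.ofReal_ne_top).1 h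
  -- transport along the ray from `τ₀`: `D(1) ≤ D(τ₀)`
  have hD := ray_transport_from hW hWm hF he hg hb hτ₀ hτ₀1 hG
  -- the ends of the ray
  have hinf : ∀ τ, ⨅ Φ, F τ 0 Φ = (periodicGroundStateEnergy (scalePot τ w) (m + 1) L).toReal :=
    fun τ => by
    unfold periodicGroundStateEnergy
    rw [ENNReal.toReal_iInf (periodicEnergy_scalePot_ne_top hW τ)]
    exact iInf_congr fun Φ => by simp [hFdef, sourcedFunctional]
  have he0τ₀ : e 0 τ₀ = (periodicGroundStateEnergy (scalePot τ₀ w) (m + 1) L).toReal := by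
    rw [he, hinf τ₀]
  have he01 : e 0 1 = (periodicGroundStateEnergy w (m + 1) L).toReal := by
    rw [he, hinf 1, scalePot_one]
  -- LOWER bound at `τ₀` from the hypothesis chord at `τ₀ • w`, read in `ℝ`
  have hesτ₀ : (periodicGroundStateEnergy (scalePot τ₀ w) (m + 1) L).toReal -
      C₁ * s ^ 2 * L ^ 2 / ‖(fun j => (n j : ℝ))‖ ^ 2 ≤ e s τ₀ := by
    refine ray_le_e he fun Φ => ?_
    have h := hchord Φ
    unfold GDIneq at h
    have hT : periodicEnergy (scalePot τ₀ w) Φ ≠ ⊤ := periodicEnergy_scalePot_ne_top hW τ₀ Φ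
    have hE0 : periodicGroundStateEnergy (scalePot τ₀ w) (m + 1) L ≠ ⊤ :=
      ne_top_of_le_ne_top hT (periodicGroundStateEnergy_le _ Φ)
    have hJ : 0 ≤ s * (2 * (m + 1) * ‖sourceIntegral m L n Φ.ψ‖) := by positivity
    have hK : 0 ≤ C₁ * s ^ 2 * L ^ 2 / ‖(fun j => (n j : ℝ))‖ ^ 2 := by positivity
    have h' := ENNReal.toReal_mono (ENNReal.add_ne_top.2 ⟨hT, ENNReal.ofReal_ne_top⟩) h
    rw [ENNReal.toReal_add hE0 ENNReal.ofReal_ne_top, ENNReal.toReal_add hT ENNReal.ofReal_ne_top,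
      ENNReal.toReal_ofReal hJ, ENNReal.toReal_ofReal hK] at h'
    simp only [hFdef, sourcedFunctional]
    linarith
  -- UPPER bound at `1`: test `Φ₀`
  have hes1 : e s 1 ≤ (periodicEnergy w Φ₀).toReal - s * (2 * (m + 1) * ‖sourceIntegral m L n Φ₀.ψ‖) := by
    simpa only [hFdef, scalePot_one, sourcedFunctional] using ray_e_le he hb (s' := s) 1 Φ₀
  -- back to `ℝ≥0∞`
  have hTw : periodicEnergy w Φ₀ ≠ ⊤ := by
    simpa only [scalePot_one] using periodicEnergy_scalePot_ne_top hW 1 Φ₀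
  have hE0w : periodicGroundStateEnergy w (m + 1) L ≠ ⊤ :=
    ne_top_of_le_ne_top hTw (periodicGroundStateEnergy_le w Φ₀)
  have hJ : 0 ≤ s * (2 * (m + 1) * ‖sourceIntegral m L n Φ₀.ψ‖) := by positivity
  have hK : 0 ≤ C₁ * s ^ 2 * L ^ 2 / ‖(fun j => (n j : ℝ))‖ ^ 2 := by positivity
  unfold GDIneq
  rw [← ENNReal.ofReal_toReal hE0w, ← ENNReal.ofReal_toReal hTw,
    ← ENNReal.ofReal_add ENNReal.toReal_nonneg hJ, ← ENNReal.ofReal_add ENNReal.toReal_nonneg hK]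
  exact ENNReal.ofReal_le_ofReal (by linarith)

end Summit.AtomisticToContinuum.BoseEinsteinCondensation.Cruxes.GaussianDominationCan.CouplingMonotoneChord

end
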